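import Mathlib
import Literature.AlgebraicGeometry.Resolution.CobordantGame
import Literature.AlgebraicGeometry.Resolution.CobordantChartCoefficients
import Literature.AlgebraicGeometry.Resolution.CobordantTupleGame
import Literature.AlgebraicGeometry.Resolution.FormalCoordinateChange
import Summits.ResolutionOfSingularities.ResolutionOfSingularities.Theorems.WeightedInvariantLocalWeightedDropWildPurePowerSteps
import Summits.ResolutionOfSingularities.ResolutionOfSingularities.Theorems.WeightedInvariantLocalWeightedDropWildPurePowerUnaryExit

/-!
# `WeightedInvariant.LocalWeightedDrop`, line `hasse-ridge-face-selection`: the DESCENT LIFT for the purely inseparable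
# surface forms — S3πM `stub_wildPurelyInseparableReductionWon` follows from ANY state-carrying measure with the
# Hauser–Perlega step property

Crux item stmt-ResolutionOfSingularities-8899 `LocalWeightedDrop` (route `ResolutionOfSingularities/WeightedInvariant`),
serving the door `WeightedConstruction` stmt-ResolutionOfSingularities-0571.  [OURS · L1 W4.3, chain w43, stub worker 1
(gen 2): the interface between the landed game-side API (point step, plane changes, cleaning, unary-cone exit, terminal
piece S3πT) and the printed descent (Hauser–Perlega PRIMS 60 (2024) §§4–6: the flag invariant `(d, n, s)` decreases under
point blow-ups at equiconstant points until a terminal case).  Not a statement of any manuscript.]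

`purePower_won_of_descent` (`q = p^e`, `k` algebraically closed of characteristic `p`).  DATA: any type of STATES with a
coefficient `germ s ∈ k[[x₁,x₂]]` and an ordinal MEASURE `μ`.  STEP PROPERTY demanded of the data, for every state whose
coefficient is a position (`ord > q`): after a free PLANE CHANGE `θ` and a free CLEANING `φ` (new position `A₁ = germ s ∘ θ + φ^q`),
EITHER `A₁` is TERMINAL (monomial / small residual — then S3πT wins it), OR for every exceptional point of the POINT BLOW-UP and
every re-centring `φ'` that turns the successor coefficient `T` into a position `T + φ'^q`, some state of SMALLER MEASURE has
that coefficient.  CONCLUSION: every state's germ `y^q + germ s` is won — because every other successor is an EXIT handled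
here once and for all: order `< q` (hypothesis on smaller orders), order `q` with a cone that is not wide
(`WildPurePower.won_of_order_eq_of_not_wide`: apex-free or axis), order `q` with wide cone (`exists_recentre_of_wide` produces
the re-centring `φ'`).  `wildPurelyInseparableReductionWon_of_descent`: S3πM VERBATIM from the existence of such data covering
every position.  What remains for S3πM is therefore exactly the MEASURE (HP's `(d, n, s)` with the boundary as state).
-/

set_option linter.dupNamespace false -- mandated namespace of this single-conjunct summit

namespace Summit.ResolutionOfSingularities.ResolutionOfSingularities.Theorems

open Literature.AlgebraicGeometry.Resolution

namespace WildPurePower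

open MvPowerSeries WildTerminal Literature.AlgebraicGeometry.Resolution.CobordantGame

/-- THE DESCENT LIFT FOR `y^q + A₀(x₁,x₂)`, `q = p^e` (see the module docstring). -/
theorem purePower_won_of_descent (p : ℕ) (hp : p.Prime) (k : Type) [Field k] [CharP k p] [IsAlgClosed k] (e : ℕ)
    (hord : ∀ g : MvPowerSeries (Fin 3) k, CobordantGame.IsSingular k g → g.order < (p ^ e : ℕ) →
      CobordantGame.Won k 3 g)
    (haxis : ∀ g : MvPowerSeries (Fin 3) k, CobordantGame.IsSingular k g → g.order = (p ^ e : ℕ) →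
      (∃ c : Fin 3 → k, c ≠ 0 ∧ ∀ v : Fin 3 → k,
        CobordantChart.initEval (fun _ : Fin 3 => 1) (v + c) (p ^ e) g =
          CobordantChart.initEval (fun _ : Fin 3 => 1) v (p ^ e) g) →
      (∀ c₁ c₂ : Fin 3 → k,
        (∀ v : Fin 3 → k, CobordantChart.initEval (fun _ : Fin 3 => 1) (v + c₁) (p ^ e) g =
          CobordantChart.initEval (fun _ : Fin 3 => 1) v (p ^ e) g) →
        (∀ v : Fin 3 → k, CobordantChart.initEval (fun _ : Fin 3 => 1) (v + c₂) (p ^ e) g =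
          CobordantChart.initEval (fun _ : Fin 3 => 1) v (p ^ e) g) →
        ∃ α β : k, (α ≠ 0 ∨ β ≠ 0) ∧ α • c₁ + β • c₂ = 0) →
      CobordantGame.Won k 3 g)
    (hterm : ∀ (A₀ : MvPowerSeries (Fin 2) k), ((p ^ e : ℕ) : ℕ∞) < A₀.order →
      ((∃ (r s : ℕ) (U : MvPowerSeries (Fin 2) k), constantCoeff U ≠ 0 ∧ ¬ (p ^ e ∣ r ∧ p ^ e ∣ s) ∧
          A₀ = X (0 : Fin 2) ^ r * X (1 : Fin 2) ^ s * U) ∨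
        (∃ (i : Fin 2) (m : ℕ) (g : MvPowerSeries (Fin 2) k), 0 < m ∧ 0 < g.order ∧ g.order < (p ^ e : ℕ) ∧
          A₀ = X i ^ (p ^ e * m) * g)) →
      CobordantGame.Won k 3 (X (Fin.last 2) ^ (p ^ e) + rename (Fin.succAboveEmb (Fin.last 2)) A₀))
    {S : Type*} (germ : S → MvPowerSeries (Fin 2) k) (μ : S → Ordinal.{0})
    (hstep : ∀ s : S, ((p ^ e : ℕ) : ℕ∞) < (germ s).order →
      ∃ (θ : Fin 2 → MvPowerSeries (Fin 2) k) (φ : MvPowerSeries (Fin 2) k),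
        (∀ i, constantCoeff (θ i) = 0) ∧ IsUnit (FormalCoordChange.linMat θ).det ∧ constantCoeff φ = 0 ∧
        ((p ^ e : ℕ) : ℕ∞) < (subst θ (germ s) + φ ^ (p ^ e)).order ∧
        (((∃ (r t : ℕ) (U : MvPowerSeries (Fin 2) k), constantCoeff U ≠ 0 ∧ ¬ (p ^ e ∣ r ∧ p ^ e ∣ t) ∧
            subst θ (germ s) + φ ^ (p ^ e) = X (0 : Fin 2) ^ r * X (1 : Fin 2) ^ t * U) ∨
          (∃ (i : Fin 2) (m : ℕ) (g : MvPowerSeries (Fin 2) k), 0 < m ∧ 0 < g.order ∧ g.order < (p ^ e : ℕ) ∧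
            subst θ (germ s) + φ ^ (p ^ e) = X i ^ (p ^ e * m) * g)) ∨
        (∀ (c : Fin 2 → k) (i₀ : Fin 2), c i₀ ≠ 0 → ∀ B₀ : MvPowerSeries (Fin (2 + 1)) k,
          subst (CobordantChart.chart (fun _ : Fin 2 => 1) c) (subst θ (germ s) + φ ^ (p ^ e)) = X 0 ^ (p ^ e + 1) * B₀ →
          ∀ φ' : MvPowerSeries (Fin 2) k, constantCoeff φ' = 0 →
            ((p ^ e : ℕ) : ℕ∞) < (TupleGame.slice i₀ (X 0 * B₀) + φ' ^ (p ^ e)).order →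
            ∃ s' : S, germ s' = TupleGame.slice i₀ (X 0 * B₀) + φ' ^ (p ^ e) ∧ μ s' < μ s))) :
    ∀ s : S, ((p ^ e : ℕ) : ℕ∞) < (germ s).order →
      CobordantGame.Won k (2 + 1) (X (Fin.last 2) ^ (p ^ e) + rename (Fin.succAboveEmb (Fin.last 2)) (germ s)) := by
  classical
  set q := p ^ e with hq
  have hq0 : 0 < q := pow_pos hp.pos e
  suffices key : ∀ (α : Ordinal.{0}) (s : S), μ s = α → ((q : ℕ) : ℕ∞) < (germ s).order →
      Won k (2 + 1) (X (Fin.last 2) ^ q + rename (Fin.succAboveEmb (Fin.last 2)) (germ s)) from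
    fun s hs => key _ s rfl hs
  intro α
  induction α using WellFoundedLT.induction with
  | ind α ih =>
  intro s hα hs
  obtain ⟨θ, φ, hθ0, hθdet, hφ0, hA₁, hbr⟩ := hstep s hs
  -- the free moves: plane change, then cleaning
  rw [← won_purePower_substX_iff θ hθ0 hθdet, ← won_purePower_recentre_iff p hp e φ hφ0]
  set A₁ := subst θ (germ s) + φ ^ q with hA₁def
  rcases hbr with hT | hpt
  · exact hterm A₁ hA₁ hT
  · -- the point blow-up; every singular successor is an exit or a smaller state
    refine won_purePower_of_pointStep p hp k hq0 A₁ hA₁ fun c i₀ hci₀ B₀ hB hSs => ?_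
    set T := TupleGame.slice i₀ (X 0 * B₀) with hTdef
    by_cases hTlt : T.order < (q : ℕ)
    · exact hord _ hSs (lt_of_le_of_lt (order_X_pow_add_rename_le hq0 T) hTlt)
    rw [not_lt] at hTlt
    have hSq : ((X (Fin.last 2) : MvPowerSeries (Fin (2 + 1)) k) ^ q + rename (Fin.succAboveEmb (Fin.last 2)) T).order = q :=
      order_X_pow_add_rename_eq hq0 T hTlt
    by_cases hwide : ∃ c₁ c₂ : Fin 3 → k, (∀ α β : k, α • c₁ + β • c₂ = 0 → α = 0 ∧ β = 0) ∧
        (∀ v : Fin 3 → k, CobordantChart.initEval (fun _ : Fin 3 => 1) (v + c₁) q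
          ((X (Fin.last 2) : MvPowerSeries (Fin (2 + 1)) k) ^ q + rename (Fin.succAboveEmb (Fin.last 2)) T) =
          CobordantChart.initEval (fun _ : Fin 3 => 1) v q
          ((X (Fin.last 2) : MvPowerSeries (Fin (2 + 1)) k) ^ q + rename (Fin.succAboveEmb (Fin.last 2)) T)) ∧
        (∀ v : Fin 3 → k, CobordantChart.initEval (fun _ : Fin 3 => 1) (v + c₂) q
          ((X (Fin.last 2) : MvPowerSeries (Fin (2 + 1)) k) ^ q + rename (Fin.succAboveEmb (Fin.last 2)) T) =
          CobordantChart.initEval (fun _ : Fin 3 => 1) v q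
          ((X (Fin.last 2) : MvPowerSeries (Fin (2 + 1)) k) ^ q + rename (Fin.succAboveEmb (Fin.last 2)) T))
    · -- wide apex: re-centre to a position, which is a smaller state
      obtain ⟨c₁, c₂, hind, h₁, h₂⟩ := hwide
      obtain ⟨φ', hφ'0, hφ'ord, hiff⟩ := exists_recentre_of_wide p hp k e T hTlt c₁ c₂ hind h₁ h₂
      obtain ⟨s', hs', hμ⟩ := hpt c i₀ hci₀ B₀ hB φ' hφ'0 hφ'ord
      rw [hiff, ← hs']
      exact ih (μ s') (hα ▸ hμ) s' rfl (by rw [hs']; exact hφ'ord)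
    · -- not wide: apex-free or axis
      exact won_of_order_eq_of_not_wide p hp k hord haxis _ hSs hSq hwide

/-- S3πM FROM A DESCENT DATUM: the registered-candidate stub `stub_wildPurelyInseparableReductionWon` (skeleton drafts
v22–v26) VERBATIM, as soon as for every algebraically closed field of characteristic `p` and every `d = p^e > 2` (under its
side hypotheses) there are states, coefficients and a measure with the step property of `purePower_won_of_descent` covering every
position.  [This is where Hauser–Perlega's flag invariant `(d, n, s)` (PRIMS 60 (2024) §5, Props 3–4) has to be supplied.] -/
theorem wildPurelyInseparableReductionWon_of_descent
    (hdesc : ∀ (p : ℕ), p.Prime → ∀ (k : Type) [Field k] [CharP k p] [IsAlgClosed k] (e : ℕ), 2 < p ^ e →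
      (∀ m : ℕ, m < 3 → ∀ g : MvPowerSeries (Fin m) k, CobordantGame.IsSingular k g → CobordantGame.Won k m g) →
      (∀ g : MvPowerSeries (Fin 3) k, CobordantGame.IsSingular k g → g.order < (p ^ e : ℕ) → CobordantGame.Won k 3 g) →
      (∀ g : MvPowerSeries (Fin 3) k, CobordantGame.IsSingular k g → g.order = (p ^ e : ℕ) →
        (∃ c : Fin 3 → k, c ≠ 0 ∧ ∀ v : Fin 3 → k,
          CobordantChart.initEval (fun _ : Fin 3 => 1) (v + c) (p ^ e) g =
            CobordantChart.initEval (fun _ : Fin 3 => 1) v (p ^ e) g) →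
        (∀ c₁ c₂ : Fin 3 → k,
          (∀ v : Fin 3 → k, CobordantChart.initEval (fun _ : Fin 3 => 1) (v + c₁) (p ^ e) g =
            CobordantChart.initEval (fun _ : Fin 3 => 1) v (p ^ e) g) →
          (∀ v : Fin 3 → k, CobordantChart.initEval (fun _ : Fin 3 => 1) (v + c₂) (p ^ e) g =
            CobordantChart.initEval (fun _ : Fin 3 => 1) v (p ^ e) g) →
          ∃ α β : k, (α ≠ 0 ∨ β ≠ 0) ∧ α • c₁ + β • c₂ = 0) →
        CobordantGame.Won k 3 g) →
      ∃ (S : Type) (germ : S → MvPowerSeries (Fin 2) k) (μ : S → Ordinal.{0}),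
        (∀ A₀ : MvPowerSeries (Fin 2) k, ((p ^ e : ℕ) : ℕ∞) < A₀.order → ∃ s, germ s = A₀) ∧
        (∀ s : S, ((p ^ e : ℕ) : ℕ∞) < (germ s).order →
          ∃ (θ : Fin 2 → MvPowerSeries (Fin 2) k) (φ : MvPowerSeries (Fin 2) k),
            (∀ i, constantCoeff (θ i) = 0) ∧ IsUnit (FormalCoordChange.linMat θ).det ∧ constantCoeff φ = 0 ∧
            ((p ^ e : ℕ) : ℕ∞) < (subst θ (germ s) + φ ^ (p ^ e)).order ∧
            (((∃ (r t : ℕ) (U : MvPowerSeries (Fin 2) k), constantCoeff U ≠ 0 ∧ ¬ (p ^ e ∣ r ∧ p ^ e ∣ t) ∧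
                subst θ (germ s) + φ ^ (p ^ e) = X (0 : Fin 2) ^ r * X (1 : Fin 2) ^ t * U) ∨
              (∃ (i : Fin 2) (m : ℕ) (g : MvPowerSeries (Fin 2) k), 0 < m ∧ 0 < g.order ∧ g.order < (p ^ e : ℕ) ∧
                subst θ (germ s) + φ ^ (p ^ e) = X i ^ (p ^ e * m) * g)) ∨
            (∀ (c : Fin 2 → k) (i₀ : Fin 2), c i₀ ≠ 0 → ∀ B₀ : MvPowerSeries (Fin (2 + 1)) k,
              subst (CobordantChart.chart (fun _ : Fin 2 => 1) c) (subst θ (germ s) + φ ^ (p ^ e)) = X 0 ^ (p ^ e + 1) * B₀ →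
              ∀ φ' : MvPowerSeries (Fin 2) k, constantCoeff φ' = 0 →
                ((p ^ e : ℕ) : ℕ∞) < (TupleGame.slice i₀ (X 0 * B₀) + φ' ^ (p ^ e)).order →
                ∃ s' : S, germ s' = TupleGame.slice i₀ (X 0 * B₀) + φ' ^ (p ^ e) ∧ μ s' < μ s)))) :
    ∀ (p : ℕ), p.Prime → ∀ (k : Type) [Field k] [CharP k p] [IsAlgClosed k],
      (∀ m : ℕ, m < 3 → ∀ g : MvPowerSeries (Fin m) k,
        CobordantGame.IsSingular k g → CobordantGame.Won k m g) →
      ∀ (d : ℕ), (∃ e : ℕ, d = p ^ e) → 2 < d →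
      (∀ g : MvPowerSeries (Fin 3) k, CobordantGame.IsSingular k g → g.order < d →
        CobordantGame.Won k 3 g) →
      (∀ g : MvPowerSeries (Fin 3) k, CobordantGame.IsSingular k g → g.order = d →
        (∃ c : Fin 3 → k, c ≠ 0 ∧ ∀ v : Fin 3 → k,
          CobordantChart.initEval (fun _ : Fin 3 => 1) (v + c) d g =
            CobordantChart.initEval (fun _ : Fin 3 => 1) v d g) →
        (∀ c₁ c₂ : Fin 3 → k,
          (∀ v : Fin 3 → k, CobordantChart.initEval (fun _ : Fin 3 => 1) (v + c₁) d g =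
            CobordantChart.initEval (fun _ : Fin 3 => 1) v d g) →
          (∀ v : Fin 3 → k, CobordantChart.initEval (fun _ : Fin 3 => 1) (v + c₂) d g =
            CobordantChart.initEval (fun _ : Fin 3 => 1) v d g) →
          ∃ α β : k, (α ≠ 0 ∨ β ≠ 0) ∧ α • c₁ + β • c₂ = 0) →
        CobordantGame.Won k 3 g) →
      (∀ (A₀ : MvPowerSeries (Fin 2) k), (d : ℕ∞) < A₀.order →
        ((∃ (r s : ℕ) (U : MvPowerSeries (Fin 2) k), MvPowerSeries.constantCoeff U ≠ 0 ∧ ¬ (d ∣ r ∧ d ∣ s) ∧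
            A₀ = MvPowerSeries.X (0 : Fin 2) ^ r * MvPowerSeries.X (1 : Fin 2) ^ s * U) ∨
          (∃ (i : Fin 2) (m : ℕ) (g : MvPowerSeries (Fin 2) k), 0 < m ∧ 0 < g.order ∧ g.order < d ∧
            A₀ = MvPowerSeries.X i ^ (d * m) * g)) →
        CobordantGame.Won k 3 (MvPowerSeries.X (Fin.last 2) ^ d +
          MvPowerSeries.rename (Fin.succAboveEmb (Fin.last 2)) A₀)) →
      ∀ (A₀ : MvPowerSeries (Fin 2) k), (d : ℕ∞) < A₀.order →
        CobordantGame.Won k 3 (MvPowerSeries.X (Fin.last 2) ^ d +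
          MvPowerSeries.rename (Fin.succAboveEmb (Fin.last 2)) A₀) := by
  intro p hp k _ _ _ hlow d hpe h2d hord haxis hterm A₀ hA₀
  obtain ⟨e, rfl⟩ := hpe
  obtain ⟨S, germ, μ, hcover, hstep⟩ := hdesc p hp k e h2d hlow hord haxis
  obtain ⟨s, hs⟩ := hcover A₀ hA₀
  have h := purePower_won_of_descent p hp k e hord haxis hterm germ μ hstep s (by rw [hs]; exact hA₀)
  rw [hs] at h
  exact h

end WildPurePower

end Summit.ResolutionOfSingularities.ResolutionOfSingularities.Theorems
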